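import Mathlib
import HarnessLib
import Literature.Analysis.FluidPDE.KatoFarFieldBound
import Literature.Analysis.FluidPDE.KatoLocalBoundedProofs
import Literature.Analysis.FluidPDE.KatoL3Uniqueness
import Literature.Analysis.FluidPDE.KatoLocalLerayPressure
import Literature.Analysis.FluidPDE.NSCriticalClosureBesovKatoClass
import Summits.NavierStokesRegularity.NavierStokesRegularity.Theorems.TypeIQuarterGateScarZoomDefs

/-!
# Line `scar_zoom` on crux `TypeIQuarterGate.ScarEnvelopeTypeI` (stmt-NavierStokesRegularity-23843) —
# STUB 0 `stub_blowupIsCompact`: tameness outside the blow-up region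

The registered infrastructure stub `stub_blowupIsCompact` (skeleton
`Cruxes/ScarEnvelopeTypeI/Lines/scar_zoom.lean`, line owner ns-idea-7 g0; the critic's price P2 made
into a stub) proved VERBATIM and UNCONDITIONALLY:

  `CruxHypotheses ν T u p → TameOutside T u`,

i.e. for some `δ > 0`, `R`, `B`: `‖u‖ ≤ B` on `[0, T−δ] × ℝ³` and on `[T−δ, T) × {R ≤ ‖x‖}`.

Proof — the Kato `C_t L³` theory of the tree (neither the Type-I rate nor the finite-scar clause is
needed): a classical Leray–Hopf solution from a rapidly decaying datum is a Kato solution on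
`[0, T)` (`isKatoSolutionOn_of_classical`); then
* FAR FIELD up to `T`: `IsKatoSolutionOn.farField_bound_holds` (Lemarié-Rieusset 2016 Thm. 15.1 (C)
  / Rusin–Šverák 2011 §4: `u ∈ L^∞((T−δ, T) × {|x| > R})`, PROVED in the tree), essential bound
  upgraded to a pointwise one by joint continuity;
* INTERIOR slab `(a, S) × ℝ³`, `0 < a < S < T`: `IsKatoSolutionOn.exists_ae_norm_le_of_pos` (Kato's
  smoothing bound `‖u(t)‖_∞ ≤ C/√t`, PROVED), again upgraded by continuity;
* INITIAL LAYER `[0, T₂/2] × ℝ³`: the datum is bounded (rapid decay), so the `L³ ∩ L^∞` local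
  theory `kato_local_bounded_holds` (Lemarié-Rieusset §9.9, PROVED) gives a Kato solution bounded by
  `2A` on a short interval, which agrees with `u` slice-wise a.e. by `kato_unique_holds`
  (Furioli–Lemarié-Rieusset–Terraneo); continuity of the slices of `u` makes the bound pointwise.

No statement about the crux, its parent `QuarterLawTypeI` or the summit is proved by this file.
-/

noncomputable section

-- the summit-side namespace `Summit.NavierStokesRegularity.NavierStokesRegularity.…` (single-conjunct
-- summit, D-0017) repeats a component by design; the dupNamespace linter would flag every declaration.
set_option linter.dupNamespace false

namespace Summit.NavierStokesRegularity.NavierStokesRegularity.Cruxes.ScarEnvelopeTypeI.ScarZoom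

open MeasureTheory Set Function Filter Topology TopologicalSpace Metric
open scoped NNReal ENNReal
open Literature.Analysis Literature.Analysis.FluidPDE

local notation "E3" => EuclideanSpace ℝ (Fin 3)

/-! ### Values of continuous functions are bounded by essential suprema -/

/-- A function continuous on an open set of space–time is bounded there, pointwise, by its essential
supremum (Lebesgue measure charges nonempty open sets). -/
private theorem norm_le_of_eLpNorm_top_of_continuousOn {O : Set (ℝ × E3)} (hO : IsOpen O)
    {u : ℝ → E3 → E3} (hh : ContinuousOn (uncurry u) O) {B : ℝ} (hB0 : 0 ≤ B)
    (hB : eLpNorm (uncurry u) ∞ (volume.restrict O) ≤ ENNReal.ofReal B) {t : ℝ} {x : E3}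
    (hx : (t, x) ∈ O) : ‖u t x‖ ≤ B := by
  have key : ‖uncurry u (t, x)‖ₑ ≤ eLpNorm (uncurry u) ∞ (volume.restrict O) := by
    by_contra hlt
    push Not at hlt
    set S : ℝ≥0∞ := eLpNorm (uncurry u) ∞ (volume.restrict O) with hS
    have hae : ∀ᵐ y ∂(volume.restrict O), ‖uncurry u y‖ₑ ≤ S := by
      rw [hS, eLpNorm_exponent_top]
      exact enorm_ae_le_eLpNormEssSup (uncurry u) _
    set W : Set (ℝ × E3) := O ∩ (fun y => ‖uncurry u y‖ₑ) ⁻¹' Ioi S with hW_def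
    have hW : IsOpen W := (continuous_enorm.comp_continuousOn hh).isOpen_inter_preimage hO isOpen_Ioi
    have hpos : 0 < volume W := hW.measure_pos volume ⟨(t, x), hx, hlt⟩
    have hzero : volume.restrict O W = 0 := by
      refine measure_mono_null (fun y hy => ?_) (ae_iff.1 hae)
      exact not_le.2 hy.2
    rw [Measure.restrict_apply hW.measurableSet, inter_eq_left.2 inter_subset_left] at hzero
    exact hpos.ne' hzero
  have h1 : ‖uncurry u (t, x)‖ₑ ≤ ENNReal.ofReal B := key.trans hB
  rw [← ofReal_norm, ENNReal.ofReal_le_ofReal_iff hB0] at h1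
  exact h1

/-- A continuous function on `ℝ³` is bounded pointwise by its essential supremum. -/
private theorem norm_le_of_eLpNorm_top_of_continuous {g : E3 → E3} (hg : Continuous g) {B : ℝ}
    (hB0 : 0 ≤ B) (hB : eLpNorm g ∞ volume ≤ ENNReal.ofReal B) (x : E3) : ‖g x‖ ≤ B := by
  have key : ‖g x‖ₑ ≤ eLpNorm g ∞ volume := by
    by_contra hlt
    push Not at hlt
    set S : ℝ≥0∞ := eLpNorm g ∞ volume with hS
    have hae : ∀ᵐ y ∂(volume : Measure E3), ‖g y‖ₑ ≤ S := by
      rw [hS, eLpNorm_exponent_top]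
      exact enorm_ae_le_eLpNormEssSup g _
    have hW : IsOpen ((fun y => ‖g y‖ₑ) ⁻¹' Ioi S) := isOpen_Ioi.preimage (continuous_enorm.comp hg)
    have hpos : 0 < volume ((fun y => ‖g y‖ₑ) ⁻¹' Ioi S) := hW.measure_pos volume ⟨x, hlt⟩
    have hzero : volume ((fun y => ‖g y‖ₑ) ⁻¹' Ioi S) = 0 := by
      refine measure_mono_null (fun y hy => ?_) (ae_iff.1 hae)
      exact not_le.2 hy
    exact hpos.ne' hzero
  have h1 : ‖g x‖ₑ ≤ ENNReal.ofReal B := key.trans hB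
  rwa [← ofReal_norm, ENNReal.ofReal_le_ofReal_iff hB0] at h1

/-! ### STUB 0 -/

/-- **STUB 0 of line `scar_zoom` (registered signature, verbatim): tameness outside the blow-up
region.**  Under the crux hypotheses there are `δ > 0`, `R`, `B` with `‖u t x‖ ≤ B` for
`t ∈ [0, T−δ]` and all `x`, and for `t ∈ [T−δ, T)` and `R ≤ ‖x‖`.  Proof by the tree's Kato theory:
far-field bound near the final time (`IsKatoSolutionOn.farField_bound_holds`), interior smoothing
bound (`exists_ae_norm_le_of_pos`), bounded initial layer (`kato_local_bounded_holds` +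
`kato_unique_holds`), and the continuity of the classical solution (essential bounds become
pointwise).  See the module docstring. -/
theorem stub_blowupIsCompact :
    ∀ (ν T : ℝ) (u : ℝ → E3 → E3) (p : ℝ → E3 → ℝ),
      CruxHypotheses ν T u p → TameOutside T u := by
  intro ν T u p hH
  obtain ⟨hν, hT, hmax, hLH, hdec, -, -⟩ := hH
  have hsol := hmax.1
  have hcontu : ContinuousOn (uncurry u) (Ico 0 T ×ˢ univ) := hsol.smooth_velocity.continuousOn
  have hkato : IsKatoSolutionOn T ν (u 0) u := isKatoSolutionOn_of_classical hν hT hsol hLH hdec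
  -- ## (1) the far field near the final time
  obtain ⟨δf, hδf, Rf, hfar⟩ := IsKatoSolutionOn.farField_bound_holds hν hT hkato
  set δ' : ℝ := min δf T with hδ'
  have hδ' : 0 < δ' := lt_min hδf hT
  have hδ'T : δ' ≤ T := min_le_right _ _
  have hδ'f : δ' ≤ δf := min_le_left _ _
  set Of : Set (ℝ × E3) := Ioo (T - δ') T ×ˢ (closedBall (0 : E3) Rf)ᶜ with hOf
  have hOf_open : IsOpen Of := isOpen_Ioo.prod isClosed_closedBall.isOpen_compl
  have hOf_sub : Of ⊆ Ioo (T - δf) T ×ˢ (closedBall (0 : E3) Rf)ᶜ :=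
    prod_mono (Ioo_subset_Ioo (by linarith) le_rfl) Subset.rfl
  have hfar' : eLpNorm (uncurry u) ∞ (volume.restrict Of) < ⊤ :=
    lt_of_le_of_lt (eLpNorm_mono_measure _ (Measure.restrict_mono hOf_sub le_rfl)) hfar
  set Bf : ℝ := (eLpNorm (uncurry u) ∞ (volume.restrict Of)).toReal with hBf
  have hBf0 : 0 ≤ Bf := ENNReal.toReal_nonneg
  have hBfle : eLpNorm (uncurry u) ∞ (volume.restrict Of) ≤ ENNReal.ofReal Bf :=
    (ENNReal.ofReal_toReal hfar'.ne).symm.le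
  have hcontOf : ContinuousOn (uncurry u) Of :=
    hcontu.mono (prod_mono (fun s hs => ⟨by linarith [hs.1], hs.2⟩) (subset_univ _))
  have hfar_pt : ∀ t ∈ Ico (T - δ' / 2) T, ∀ x : E3, Rf + 1 ≤ ‖x‖ → ‖u t x‖ ≤ Bf := by
    intro t ht x hx
    have hmem : ((t, x) : ℝ × E3) ∈ Of := by
      refine ⟨⟨by linarith [ht.1], ht.2⟩, ?_⟩
      rw [mem_compl_iff, mem_closedBall, dist_zero_right, not_le]
      linarith
    exact norm_le_of_eLpNorm_top_of_continuousOn hOf_open hcontOf hBf0 hBfle hmem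
  -- ## (2) the initial layer: the datum is bounded, local `L³ ∩ L^∞` theory and uniqueness
  obtain ⟨C0, hC0⟩ := hdec 0 0
  set A : ℝ := max C0 1 with hA
  have hA0 : 0 < A := lt_of_lt_of_le one_pos (le_max_right _ _)
  have hu0bd : ∀ x, ‖u 0 x‖ ≤ A := by
    intro x
    have h := hC0 x
    rw [pow_zero, one_mul, norm_iteratedFDeriv_zero] at h
    exact h.trans (le_max_left _ _)
  have hu0ess : eLpNorm (u 0) ∞ volume ≤ ENNReal.ofReal A := by
    rw [eLpNorm_exponent_top]
    exact eLpNormEssSup_le_of_ae_bound (Eventually.of_forall hu0bd)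
  have h₃ : MemLp (u 0) 3 volume := hkato.memLp_initial hT
  have hdiv0 : IsWeaklyDivFree (u 0) := hkato.isWeaklyDivFree_initial hT
  obtain ⟨c₀, hc₀, hloc⟩ := kato_local_bounded_holds
  obtain ⟨w, hw, hwbd⟩ := hloc hν hA0 h₃ hdiv0 hu0ess
  set T₀ : ℝ := c₀ * ν / A ^ 2 with hT₀
  have hT₀pos : 0 < T₀ := by positivity
  set T₂ : ℝ := min T T₀ with hT₂
  have hT₂pos : 0 < T₂ := lt_min hT hT₀pos
  have hinit_pt : ∀ t ∈ Icc 0 (T₂ / 2), ∀ x : E3, ‖u t x‖ ≤ 2 * A := by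
    intro t ht x
    have htT : t < T := lt_of_le_of_lt ht.2 (by linarith [min_le_left T T₀])
    have htT₀ : t < T₀ := lt_of_le_of_lt ht.2 (by linarith [min_le_right T T₀])
    have hae : u t =ᵐ[volume] w t := IsKatoSolutionOn.ae_eq kato_unique_holds hν hkato hw ht.1 htT htT₀
    have hess : eLpNorm (u t) ∞ volume ≤ ENNReal.ofReal (2 * A) := by
      rw [eLpNorm_congr_ae hae]
      exact hwbd t ⟨ht.1, htT₀⟩
    have hcont_t : Continuous (u t) := (hsol.contDiff_velocity ⟨ht.1, htT⟩).continuous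
    exact norm_le_of_eLpNorm_top_of_continuous hcont_t (by positivity) hess x
  -- ## (3) the interior slab `(T₂/4, T − δ'/4) × ℝ³`
  obtain ⟨M, hM⟩ := hkato.exists_ae_norm_le_of_pos hν (a := T₂ / 4) (S := T - δ' / 4)
    (by positivity) (by linarith)
  set Oi : Set (ℝ × E3) := Ioo (T₂ / 4) (T - δ' / 4) ×ˢ (univ : Set E3) with hOi
  have hOi_open : IsOpen Oi := isOpen_Ioo.prod isOpen_univ
  set Mi : ℝ := max M 0 with hMi
  have hMi0 : 0 ≤ Mi := le_max_right _ _
  have hMess : eLpNorm (uncurry u) ∞ (volume.restrict Oi) ≤ ENNReal.ofReal Mi := by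
    rw [eLpNorm_exponent_top]
    refine eLpNormEssSup_le_of_ae_bound ?_
    filter_upwards [hM] with z hz
    exact hz.trans (le_max_left _ _)
  have hT₂T : T₂ ≤ T := min_le_left _ _
  have hcontOi : ContinuousOn (uncurry u) Oi :=
    hcontu.mono (prod_mono (fun s hs => ⟨by linarith [hs.1], by linarith [hs.2]⟩) Subset.rfl)
  have hint_pt : ∀ t ∈ Ioo (T₂ / 4) (T - δ' / 4), ∀ x : E3, ‖u t x‖ ≤ Mi := fun t ht x =>
    norm_le_of_eLpNorm_top_of_continuousOn hOi_open hcontOi hMi0 hMess ⟨ht, mem_univ x⟩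
  -- ## (4) assembly
  refine ⟨δ' / 2, Rf + 1, max (max (2 * A) Mi) Bf, by positivity, ?_, ?_⟩
  · intro t ht x
    by_cases hsmall : t ≤ T₂ / 2
    · exact (hinit_pt t ⟨ht.1, hsmall⟩ x).trans ((le_max_left _ _).trans (le_max_left _ _))
    · push Not at hsmall
      have ht' : t ∈ Ioo (T₂ / 4) (T - δ' / 4) := ⟨by linarith, by linarith [ht.2]⟩
      exact (hint_pt t ht' x).trans ((le_max_right _ _).trans (le_max_left _ _))
  · intro t ht x hx
    exact (hfar_pt t ht x hx).trans (le_max_right _ _)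

end Summit.NavierStokesRegularity.NavierStokesRegularity.Cruxes.ScarEnvelopeTypeI.ScarZoom

end
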